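import Mathlib
import Literature.NumberTheory.LFunctions.Zhang2022.SkeletonPartThree
import HarnessLib

/-!
# Zhang (2022), §16 p. 95: "`𝓡₂ⱼ = −1/(β₁L′(1,χ)) + O(𝓛⁶)`" — the closed-form residues of (16.11)
# evaluated, kernel-checked

Topic `Literature/NumberTheory/LFunctions/Zhang2022` (Landau–Siegel audit tree; verdict-neutral).
Y. Zhang, *Discrete mean estimates and the Landau–Siegel zero*, arXiv:2211.02515v1 (2022)
[Zhang2022LandauSiegel] — **an unrefereed manuscript under adjudication**. §16 p. 95 (tex L4674,
DAG `Z22:§16.u043`, second half):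

> by Lemma 5.8 and direct calculation, … `𝓡₂ⱼ = −1/(β₁L′(1,χ)) + O(𝓛⁶)`, `j = 1, 2`,

where `𝓡₂₁ = [ζ(1−β₁)L(1−β₁,χ)]⁻¹P₄^{β₂−β₁}ω₁(β₂−β₁)/(β₂−β₁)` and
`𝓡₂₂ = ζ(1+β₁−β₂)/(ζ(1−β₂)L(1−β₂,χ))` are the residues of (16.11) (`Section16ResidueLimits`).
This file carries out the "direct calculation" with explicit sizes: the inputs are the tree's
Lemma 5.8 (`Lemma58.lemma_5_8_of_le`: `L(1+z,χ) = zL′(1,χ) + O(𝓛⁻¹⁵)` for `|z| ≤ 10π𝓛⁻⁹`, under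
(A)), Lemma 5.7 (`Lemma57.lemma_5_7`: `|L′(1,χ)| ≥ (4e)⁻¹`), Mathlib's `ζ(1+z) − 1/z → γ`
(`tendsto_riemannZeta_sub_one_div`, used as `|ζ(1+z) − 1/z| ≤ M` near `0`), and the elementary sizes
of `β₁ = iα(1−5c′α𝓛)`, `β₂ = 2iα(1+c′α𝓛)`, `β₂ − β₁ = iα(1+7c′α𝓛)`, `α = π𝓛⁻⁹`,
`log P₄ = 𝓛⁹ − 2𝓛^{1.1} + 519 log 𝓛`. Main results: `residueOne_estimate`, `residueTwo_estimate`
(pointwise, all sizes as hypotheses) — the `ForAllLarge` packaging against the typed node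
`Typed.Section16B.Step16_u043` is the companion `Section16RhoTwo`.

Nothing else of §16 is asserted; nothing about Theorems 1–2 of the source.

## References

* Y. Zhang, arXiv:2211.02515v1 (2022), §16 (16.11), p. 95; §5 Lemmas 5.7, 5.8; §2 (2.13).
  [cite: Zhang2022LandauSiegel, §16 p.95]
-/

noncomputable section

open Complex Real Filter Topology

namespace Literature.NumberTheory.LFunctions.Zhang2022.Skeleton

/-! ## Three generic perturbation lemmas -/

section Generic

/-- Inverting an approximation: if `|w − w₀| ≤ δ|w₀|` with `δ ≤ 1/2`, `w₀ ≠ 0`, then `w ≠ 0` and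
`|w⁻¹ − w₀⁻¹| ≤ 2δ|w₀⁻¹|`. [folklore] -/
private theorem inv_near {w w₀ : ℂ} {δ : ℝ} (hw₀ : w₀ ≠ 0) (hδ : δ ≤ 1 / 2)
    (h : ‖w - w₀‖ ≤ δ * ‖w₀‖) : w ≠ 0 ∧ ‖w⁻¹ - w₀⁻¹‖ ≤ 2 * δ * ‖w₀⁻¹‖ := by
  have hn₀ : 0 < ‖w₀‖ := norm_pos_iff.mpr hw₀
  have hδ0 : 0 ≤ δ := by nlinarith [norm_nonneg (w - w₀)]
  have hw : ‖w₀‖ / 2 ≤ ‖w‖ := by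
    have := norm_sub_norm_le w₀ w
    rw [norm_sub_rev] at this
    nlinarith
  have hwne : w ≠ 0 := by
    intro h0; rw [h0, norm_zero] at hw; linarith
  refine ⟨hwne, ?_⟩
  have hid : w⁻¹ - w₀⁻¹ = (w₀ - w) / (w * w₀) := by field_simp
  rw [hid, norm_div, norm_mul, norm_inv, norm_sub_rev,
    div_le_iff₀ (mul_pos (norm_pos_iff.mpr hwne) hn₀)]
  calc ‖w - w₀‖ ≤ δ * ‖w₀‖ := h
    _ = 2 * δ * ‖w₀‖⁻¹ * (‖w₀‖ / 2 * ‖w₀‖) := by field_simp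
    _ ≤ 2 * δ * ‖w₀‖⁻¹ * (‖w‖ * ‖w₀‖) := by gcongr

/-- A four-factor product of approximations: if `|xᵢ − yᵢ| ≤ δᵢ|yᵢ|` with `0 ≤ δᵢ ≤ 1`
(`δ₁ ≤ 1` is not needed), then
`|x₁x₂x₃x₄ − y₁y₂y₃y₄| ≤ 8(δ₁+δ₂+δ₃+δ₄)|y₁y₂y₃y₄|`. [folklore] -/
private theorem prod4_near {x₁ x₂ x₃ x₄ y₁ y₂ y₃ y₄ : ℂ} {δ₁ δ₂ δ₃ δ₄ : ℝ}
    (h₁ : ‖x₁ - y₁‖ ≤ δ₁ * ‖y₁‖) (h₂ : ‖x₂ - y₂‖ ≤ δ₂ * ‖y₂‖) (h₃ : ‖x₃ - y₃‖ ≤ δ₃ * ‖y₃‖)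
    (h₄ : ‖x₄ - y₄‖ ≤ δ₄ * ‖y₄‖) (hδ₁ : 0 ≤ δ₁) (hδ₂ : 0 ≤ δ₂) (hδ₃ : 0 ≤ δ₃) (hδ₄ : 0 ≤ δ₄)
    (hδ₂' : δ₂ ≤ 1) (hδ₃' : δ₃ ≤ 1) (hδ₄' : δ₄ ≤ 1) :
    ‖x₁ * x₂ * x₃ * x₄ - y₁ * y₂ * y₃ * y₄‖ ≤
      8 * (δ₁ + δ₂ + δ₃ + δ₄) * ‖y₁ * y₂ * y₃ * y₄‖ := by
  have hx : ∀ {x y : ℂ} {δ : ℝ}, ‖x - y‖ ≤ δ * ‖y‖ → δ ≤ 1 → ‖x‖ ≤ 2 * ‖y‖ := by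
    intro x y δ h hδ
    calc ‖x‖ = ‖(x - y) + y‖ := by ring_nf
      _ ≤ ‖x - y‖ + ‖y‖ := norm_add_le _ _
      _ ≤ δ * ‖y‖ + ‖y‖ := by gcongr
      _ ≤ 2 * ‖y‖ := by nlinarith [norm_nonneg y]
  have b₂ := hx h₂ hδ₂'
  have b₃ := hx h₃ hδ₃'
  have b₄ := hx h₄ hδ₄'
  have hid : x₁ * x₂ * x₃ * x₄ - y₁ * y₂ * y₃ * y₄ =
      (x₁ - y₁) * x₂ * x₃ * x₄ + y₁ * (x₂ - y₂) * x₃ * x₄ + y₁ * y₂ * (x₃ - y₃) * x₄ +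
        y₁ * y₂ * y₃ * (x₄ - y₄) := by ring
  rw [hid]
  have n1 := norm_nonneg y₁; have n2 := norm_nonneg y₂; have n3 := norm_nonneg y₃
  have n4 := norm_nonneg y₄
  calc ‖(x₁ - y₁) * x₂ * x₃ * x₄ + y₁ * (x₂ - y₂) * x₃ * x₄ + y₁ * y₂ * (x₃ - y₃) * x₄ +
        y₁ * y₂ * y₃ * (x₄ - y₄)‖
      ≤ ‖x₁ - y₁‖ * ‖x₂‖ * ‖x₃‖ * ‖x₄‖ + ‖y₁‖ * ‖x₂ - y₂‖ * ‖x₃‖ * ‖x₄‖ +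
          ‖y₁‖ * ‖y₂‖ * ‖x₃ - y₃‖ * ‖x₄‖ + ‖y₁‖ * ‖y₂‖ * ‖y₃‖ * ‖x₄ - y₄‖ := by
        refine (norm_add_le _ _).trans ?_
        gcongr
        · refine (norm_add_le _ _).trans ?_
          gcongr
          · refine (norm_add_le _ _).trans ?_
            gcongr <;> simp only [norm_mul, le_refl]
          · simp only [norm_mul, le_refl]
        · simp only [norm_mul, le_refl]
    _ ≤ δ₁ * ‖y₁‖ * (2 * ‖y₂‖) * (2 * ‖y₃‖) * (2 * ‖y₄‖) +
          ‖y₁‖ * (δ₂ * ‖y₂‖) * (2 * ‖y₃‖) * (2 * ‖y₄‖) +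
          ‖y₁‖ * ‖y₂‖ * (δ₃ * ‖y₃‖) * (2 * ‖y₄‖) + ‖y₁‖ * ‖y₂‖ * ‖y₃‖ * (δ₄ * ‖y₄‖) := by
        gcongr
    _ = (8 * δ₁ + 4 * δ₂ + 2 * δ₃ + δ₄) * (‖y₁‖ * ‖y₂‖ * ‖y₃‖ * ‖y₄‖) := by ring
    _ ≤ 8 * (δ₁ + δ₂ + δ₃ + δ₄) * (‖y₁‖ * ‖y₂‖ * ‖y₃‖ * ‖y₄‖) := by
        gcongr ?_ * _
        linarith
    _ = 8 * (δ₁ + δ₂ + δ₃ + δ₄) * ‖y₁ * y₂ * y₃ * y₄‖ := by simp only [norm_mul]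

/-- **`ζ(1+z) = 1/z + O(1)` near `z = 0`** (from Mathlib's `ζ(s) − 1/(s−1) → γ`): there are `r > 0`
and `M ≥ 0` with `|ζ(1+z) − z⁻¹| ≤ M` for `0 < |z| < r`. [folklore] -/
private theorem zeta_near_one : ∃ r : ℝ, 0 < r ∧ ∃ M : ℝ, 0 ≤ M ∧ ∀ z : ℂ, z ≠ 0 → ‖z‖ < r →
    ‖riemannZeta (1 + z) - z⁻¹‖ ≤ M := by
  have h := tendsto_riemannZeta_sub_one_div
  have h2 := Metric.tendsto_nhds.mp h 1 one_pos
  rw [eventually_nhdsWithin_iff, Metric.eventually_nhds_iff] at h2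
  obtain ⟨r, hr, hball⟩ := h2
  refine ⟨r, hr, ‖(Real.eulerMascheroniConstant : ℂ)‖ + 1, by positivity, fun z hz hzr => ?_⟩
  have hmem : dist (1 + z) (1 : ℂ) < r := by simpa [dist_eq_norm] using hzr
  have hne : (1 + z : ℂ) ∈ ({1}ᶜ : Set ℂ) := by simpa using hz
  have h3 := hball hmem hne
  rw [dist_eq_norm, add_sub_cancel_left, one_div] at h3
  calc ‖riemannZeta (1 + z) - z⁻¹‖
      = ‖(riemannZeta (1 + z) - z⁻¹ - Real.eulerMascheroniConstant) +
          (Real.eulerMascheroniConstant : ℂ)‖ := by ring_nf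
    _ ≤ ‖riemannZeta (1 + z) - z⁻¹ - Real.eulerMascheroniConstant‖ +
          ‖(Real.eulerMascheroniConstant : ℂ)‖ := norm_add_le _ _
    _ ≤ 1 + ‖(Real.eulerMascheroniConstant : ℂ)‖ := by gcongr
    _ = _ := by ring

end Generic

/-! ## The two residues against `−1/(β₁L′)`: the "direct calculation" with explicit sizes -/

section Cores

/-- **The residue at `s = −β₁`, core estimate.** With `ζ₁ = ζ(1−β₁)`, `L₁ = L(1−β₁,χ)`,
`L = L′(1,χ)`, `p = P₄^{β₂−β₁}`, `q = ω₁(β₂−β₁)/(β₂−β₁)`, `γ = β₂ − β₁`: if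
`|ζ₁ + 1/β₁| ≤ M` (ζ near its pole), `|L₁ + β₁L| ≤ E` (Lemma 5.8), `|p + 1| ≤ δ₃`, `|q − 1/γ| ≤ δ₄/|γ|`,
and the sizes `α/2 ≤ |β₁| ≤ 2α`, `4Mα ≤ 1/2`, `E ≤ |β₁||L|/4`, `δ₃, δ₄ ≤ 1`, then `ζ₁ ≠ 0`, `L₁ ≠ 0` and
`|ζ₁⁻¹L₁⁻¹pq + (Lγ)⁻¹| ≤ 8(4Mα + 2E/(|β₁||L|) + δ₃ + δ₄)·|Lγ|⁻¹`
(the main term: `(−β₁)·(−(β₁L)⁻¹)·(−1)·γ⁻¹ = −(Lγ)⁻¹`). [cite: Zhang2022LandauSiegel, §16 p.95] -/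
theorem residue_core_one {ζ₁ L₁ p q β₁ γ L : ℂ} {M E δ₃ δ₄ α : ℝ}
    (hα : 0 < α) (hβl : α / 2 ≤ ‖β₁‖) (hβu : ‖β₁‖ ≤ 2 * α) (hγ : γ ≠ 0) (hL : L ≠ 0)
    (hM : 0 ≤ M) (hMα : 4 * M * α ≤ 1 / 2) (hz : ‖ζ₁ - (-β₁)⁻¹‖ ≤ M)
    (hE : 0 ≤ E) (hEs : E ≤ ‖β₁‖ * ‖L‖ / 4) (hLz : ‖L₁ - (-(β₁ * L))‖ ≤ E)
    (hδ₃ : 0 ≤ δ₃) (hδ₃' : δ₃ ≤ 1) (hp : ‖p - (-1)‖ ≤ δ₃)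
    (hδ₄ : 0 ≤ δ₄) (hδ₄' : δ₄ ≤ 1) (hq : ‖q - γ⁻¹‖ ≤ δ₄ * ‖γ⁻¹‖) :
    ζ₁ ≠ 0 ∧ L₁ ≠ 0 ∧
      ‖ζ₁⁻¹ * L₁⁻¹ * p * q - (-(L * γ)⁻¹)‖ ≤
        8 * (4 * M * α + 2 * (E / (‖β₁‖ * ‖L‖)) + δ₃ + δ₄) * ‖(L * γ)⁻¹‖ := by
  have hβpos : 0 < ‖β₁‖ := by linarith
  have hβ0 : β₁ ≠ 0 := norm_pos_iff.mp hβpos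
  have hLpos : 0 < ‖L‖ := norm_pos_iff.mpr hL
  -- factor 1: `ζ₁⁻¹` against `−β₁`
  have hw₀ : (-β₁)⁻¹ ≠ 0 := inv_ne_zero (neg_ne_zero.mpr hβ0)
  have hz' : ‖ζ₁ - (-β₁)⁻¹‖ ≤ (M * ‖β₁‖) * ‖(-β₁)⁻¹‖ := by
    rw [norm_inv, norm_neg, mul_assoc, mul_inv_cancel₀ hβpos.ne', mul_one]; exact hz
  have hMβ : M * ‖β₁‖ ≤ 1 / 2 := by nlinarith
  obtain ⟨hζ0, h1⟩ := inv_near hw₀ hMβ hz'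
  rw [inv_inv] at h1
  have h1' : ‖ζ₁⁻¹ - (-β₁)‖ ≤ (4 * M * α) * ‖-β₁‖ := by
    refine h1.trans ?_
    rw [norm_neg]
    have := mul_le_mul_of_nonneg_left hβu (by positivity : 0 ≤ 2 * M * ‖β₁‖)
    nlinarith
  -- factor 2: `L₁⁻¹` against `−(β₁L)⁻¹`
  have hw₁ : -(β₁ * L) ≠ 0 := neg_ne_zero.mpr (mul_ne_zero hβ0 hL)
  set η : ℝ := E / (‖β₁‖ * ‖L‖) with hη
  have hη0 : 0 ≤ η := by positivity
  have hη4 : η ≤ 1 / 4 := by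
    rw [hη, div_le_iff₀ (mul_pos hβpos hLpos)]; linarith
  have hLz' : ‖L₁ - (-(β₁ * L))‖ ≤ η * ‖-(β₁ * L)‖ := by
    rw [norm_neg, norm_mul, hη, div_mul_cancel₀ _ (mul_pos hβpos hLpos).ne']; exact hLz
  obtain ⟨hL₁0, h2⟩ := inv_near hw₁ (by linarith) hLz'
  -- factors 3, 4 are `hp`, `hq` (against `−1` and `γ⁻¹`)
  have hp' : ‖p - (-1)‖ ≤ δ₃ * ‖(-1 : ℂ)‖ := by rw [norm_neg, norm_one, mul_one]; exact hp
  -- the product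
  have key := prod4_near h1' h2 hp' hq (by positivity) (by positivity) hδ₃ hδ₄ (by linarith) hδ₃' hδ₄'
  have hy : (-β₁) * (-(β₁ * L))⁻¹ * (-1) * γ⁻¹ = -(L * γ)⁻¹ := by
    field_simp
  rw [hy, norm_neg] at key
  exact ⟨hζ0, hL₁0, key⟩

/-- **The residue at `s = −β₂`, core estimate.** With `ζ₂ = ζ(1+β₁−β₂) = ζ(1−γ)`, `ζ₃ = ζ(1−β₂)`,
`L₂ = L(1−β₂,χ)`, `L = L′(1,χ)`, `γ = β₂ − β₁`: if `|ζ₂ + 1/γ| ≤ M`, `|ζ₃ + 1/β₂| ≤ M`, `|L₂ + β₂L| ≤ E`,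
and the sizes `α ≤ |β₂| ≤ 3α`, `|γ| ≤ 2α`, `6Mα ≤ 1/2`, `E ≤ |β₂||L|/4`, then `ζ₃ ≠ 0`, `L₂ ≠ 0` and
`|ζ₂ζ₃⁻¹L₂⁻¹ + (Lγ)⁻¹| ≤ 8(2Mα + 6Mα + 2E/(|β₂||L|))·|Lγ|⁻¹`
(the main term: `(−γ)⁻¹·(−β₂)·(−(β₂L)⁻¹) = −(Lγ)⁻¹`). [cite: Zhang2022LandauSiegel, §16 p.95] -/
theorem residue_core_two {ζ₂ ζ₃ L₂ β₂ γ L : ℂ} {M E α : ℝ}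
    (hα : 0 < α) (hβl : α ≤ ‖β₂‖) (hβu : ‖β₂‖ ≤ 3 * α) (hγ : γ ≠ 0) (hγu : ‖γ‖ ≤ 2 * α)
    (hL : L ≠ 0) (hM : 0 ≤ M) (hMα : 6 * M * α ≤ 1 / 2)
    (hz₂ : ‖ζ₂ - (-γ)⁻¹‖ ≤ M) (hz₃ : ‖ζ₃ - (-β₂)⁻¹‖ ≤ M)
    (hE : 0 ≤ E) (hEs : E ≤ ‖β₂‖ * ‖L‖ / 4) (hLz : ‖L₂ - (-(β₂ * L))‖ ≤ E) :
    ζ₃ ≠ 0 ∧ L₂ ≠ 0 ∧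
      ‖ζ₂ * ζ₃⁻¹ * L₂⁻¹ - (-(L * γ)⁻¹)‖ ≤
        8 * (2 * M * α + 6 * M * α + 2 * (E / (‖β₂‖ * ‖L‖)) + 0) * ‖(L * γ)⁻¹‖ := by
  have hβpos : 0 < ‖β₂‖ := by linarith
  have hβ0 : β₂ ≠ 0 := norm_pos_iff.mp hβpos
  have hLpos : 0 < ‖L‖ := norm_pos_iff.mpr hL
  have hγpos : 0 < ‖γ‖ := norm_pos_iff.mpr hγ
  -- factor 1: `ζ₂` against `(−γ)⁻¹`
  have h1 : ‖ζ₂ - (-γ)⁻¹‖ ≤ (2 * M * α) * ‖(-γ)⁻¹‖ := by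
    rw [norm_inv, norm_neg]
    refine hz₂.trans ?_
    rw [show 2 * M * α * ‖γ‖⁻¹ = (2 * M * α) / ‖γ‖ by ring, le_div_iff₀ hγpos]
    nlinarith [mul_le_mul_of_nonneg_left hγu hM]
  -- factor 2: `ζ₃⁻¹` against `−β₂`
  have hw₀ : (-β₂)⁻¹ ≠ 0 := inv_ne_zero (neg_ne_zero.mpr hβ0)
  have hz' : ‖ζ₃ - (-β₂)⁻¹‖ ≤ (M * ‖β₂‖) * ‖(-β₂)⁻¹‖ := by
    rw [norm_inv, norm_neg, mul_assoc, mul_inv_cancel₀ hβpos.ne', mul_one]; exact hz₃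
  have hMβ : M * ‖β₂‖ ≤ 1 / 2 := by nlinarith
  obtain ⟨hζ0, h2⟩ := inv_near hw₀ hMβ hz'
  rw [inv_inv] at h2
  have h2' : ‖ζ₃⁻¹ - (-β₂)‖ ≤ (6 * M * α) * ‖-β₂‖ := by
    refine h2.trans ?_
    rw [norm_neg]
    have := mul_le_mul_of_nonneg_left hβu (by positivity : 0 ≤ 2 * M * ‖β₂‖)
    nlinarith
  -- factor 3: `L₂⁻¹` against `−(β₂L)⁻¹`
  have hw₁ : -(β₂ * L) ≠ 0 := neg_ne_zero.mpr (mul_ne_zero hβ0 hL)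
  set η : ℝ := E / (‖β₂‖ * ‖L‖) with hη
  have hη0 : 0 ≤ η := by positivity
  have hη4 : η ≤ 1 / 4 := by
    rw [hη, div_le_iff₀ (mul_pos hβpos hLpos)]; linarith
  have hLz' : ‖L₂ - (-(β₂ * L))‖ ≤ η * ‖-(β₂ * L)‖ := by
    rw [norm_neg, norm_mul, hη, div_mul_cancel₀ _ (mul_pos hβpos hLpos).ne']; exact hLz
  obtain ⟨hL₂0, h3⟩ := inv_near hw₁ (by linarith) hLz'
  -- factor 4: `1` against `1`
  have h4 : ‖(1 : ℂ) - 1‖ ≤ 0 * ‖(1 : ℂ)‖ := by simp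
  have key := prod4_near h1 h2' h3 h4 (by positivity) (by positivity) (by positivity) le_rfl
    (by linarith) (by linarith) zero_le_one
  have hy : (-γ)⁻¹ * (-β₂) * (-(β₂ * L))⁻¹ * 1 = -(L * γ)⁻¹ := by
    field_simp
  rw [hy, mul_one, norm_neg] at key
  exact ⟨hζ0, hL₂0, key⟩

/-- **The common main term against the printed one**: `|−(Lγ)⁻¹ + (β₁L)⁻¹| = |γ − β₁|/(|β₁||γ||L|)`,
so with `γ = β₂ − β₁`, `γ − β₁ = β₂ − 2β₁ = 12ic′α²𝓛` (`|γ − β₁| ≤ ν`), `|β₁|, |γ| ≥ α/2`: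
`≤ 4ν/(α²|L|)`. [cite: Zhang2022LandauSiegel, §16 p.95] -/
theorem main_term_shift {β₁ γ L : ℂ} {α ν : ℝ} (hα : 0 < α) (hβl : α / 2 ≤ ‖β₁‖)
    (hγl : α / 2 ≤ ‖γ‖) (hL : L ≠ 0) (hν : ‖γ - β₁‖ ≤ ν) :
    ‖-(L * γ)⁻¹ - (-(β₁ * L)⁻¹)‖ ≤ 4 * ν / (α ^ 2 * ‖L‖) := by
  have hβpos : 0 < ‖β₁‖ := by linarith
  have hγpos : 0 < ‖γ‖ := by linarith
  have hβ0 : β₁ ≠ 0 := norm_pos_iff.mp hβpos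
  have hγ0 : γ ≠ 0 := norm_pos_iff.mp hγpos
  have hLpos : 0 < ‖L‖ := norm_pos_iff.mpr hL
  have hν0 : 0 ≤ ν := le_trans (norm_nonneg _) hν
  have hid : -(L * γ)⁻¹ - (-(β₁ * L)⁻¹) = (γ - β₁) / (β₁ * γ * L) := by
    field_simp; ring
  have hsq : α ^ 2 ≤ (2 * ‖β₁‖) * (2 * ‖γ‖) := by
    rw [sq]; exact mul_le_mul (by linarith) (by linarith) hα.le (by linarith)
  rw [hid, norm_div, norm_mul, norm_mul, div_le_div_iff₀ (by positivity) (by positivity)]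
  calc ‖γ - β₁‖ * (α ^ 2 * ‖L‖) ≤ ν * ((2 * ‖β₁‖) * (2 * ‖γ‖) * ‖L‖) :=
        mul_le_mul hν (mul_le_mul_of_nonneg_right hsq (norm_nonneg _)) (by positivity) hν0
    _ = 4 * ν * (‖β₁‖ * ‖γ‖ * ‖L‖) := by ring

end Cores

end Literature.NumberTheory.LFunctions.Zhang2022.Skeleton
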